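import Mathlib

/-!
# SoloBlind — the gap–angle ("Temple") inequality: CCM's Step 2 from a spectral gap

Connes–Consani–Moscovici (arXiv:2511.22755, §7, "Step 2") ask that the even ground state `ξ_λ`
of the windowed Weil form be well approximated by the explicit prolate vector `k_λ = E(h_λ)`.
The mechanism isolated here is elementary and uses **no positivity**: for a symmetric bilinear
form `B` on a real inner product space, a unit vector `ψ` satisfying the Euler–Lagrange
condition `B ψ y = 0` for `y ⊥ ψ` (any critical point of the Rayleigh quotient, in particular a
ground state) with `B ψ ψ = ε₀`, and a lower bound `ε₁ ‖y‖² ≤ B y y` on `ψ^⊥`, EVERY vector `g`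
obeys

  `(ε₁ - ε₀) · (‖g‖² - ⟪ψ, g⟫²) ≤ B g g - ε₀ ‖g‖²`                    (`soloBlind_temple_gap`),

so a trial vector whose Rayleigh quotient `q` is close to the bottom *relative to the gap* is close
in angle to the ground state: `sin² θ ≤ (q - ε₀)/(ε₁ - ε₀)` (`soloBlind_temple_angle`), and for a
unit trial vector `‖g - σ ψ‖² ≤ 2 (q - ε₀)/(ε₁ - ε₀)` for a sign `σ = ±1`
(`soloBlind_temple_dist`). The statements are invariant under `B ↦ B + const · ⟪·,·⟫`: only
RELATIVE spectral data enter. Applied to the windowed Weil form (zero side, numerically, under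
RH) with `g = k_λ`: `q - ε₀ ≍ 1 - χ₄(λ)` (prolate leakage, Fuchs 1964) while `ε₁ - ε₀ ≍ 1 - χ₈(λ)`,
whence `sin² θ ≲ c⁻⁴`, `c = 2πλ²` — the measured `2(1 - overlap) = 3.4e-7` at `log λ = 1` against
`(q-ε₀)/(ε₁-ε₀) ≈ 2.6e-7` (solo-blind s8, HOME/paper/step1-parity.md §13). [folklore linear algebra;
the application is the residency's]
-/

namespace Summit.RiemannHypothesis.RiemannHypothesis.Theorems

open scoped InnerProductSpace RealInnerProductSpace

variable {E : Type*} [NormedAddCommGroup E] [InnerProductSpace ℝ E]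

/-- **Gap–angle (Temple) inequality.** `B` symmetric bilinear, `ψ` a unit vector with
`B ψ ψ = ε₀` which is `B`-orthogonal to `ψ^⊥` (Euler–Lagrange), and `ε₁ ‖y‖² ≤ B y y` on `ψ^⊥`.
Then `(ε₁ - ε₀)(‖g‖² - ⟪ψ,g⟫²) ≤ B g g - ε₀ ‖g‖²` for every `g`. No sign condition on `ε₀, ε₁`.
[folklore] -/
theorem soloBlind_temple_gap (B : E →ₗ[ℝ] E →ₗ[ℝ] ℝ) (hB : ∀ x y, B x y = B y x)
    (ψ : E) (hψ : ‖ψ‖ = 1) (ε₀ ε₁ : ℝ) (hε : B ψ ψ = ε₀)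
    (hEL : ∀ y, ⟪ψ, y⟫_ℝ = 0 → B ψ y = 0)
    (hgap : ∀ y, ⟪ψ, y⟫_ℝ = 0 → ε₁ * ‖y‖ ^ 2 ≤ B y y) (g : E) :
    (ε₁ - ε₀) * (‖g‖ ^ 2 - ⟪ψ, g⟫_ℝ ^ 2) ≤ B g g - ε₀ * ‖g‖ ^ 2 := by
  set c := ⟪ψ, g⟫_ℝ with hc
  set y := g - c • ψ with hy
  have hψψ : ⟪ψ, ψ⟫_ℝ = 1 := by
    rw [real_inner_self_eq_norm_sq, hψ, one_pow]
  have hyo : ⟪ψ, y⟫_ℝ = 0 := by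
    rw [hy, inner_sub_right, real_inner_smul_right, hψψ, mul_one, ← hc, sub_self]
  have hny : ‖y‖ ^ 2 = ‖g‖ ^ 2 - c ^ 2 := by
    have h1 : ‖y‖ ^ 2 = ⟪y, y⟫_ℝ := (real_inner_self_eq_norm_sq y).symm
    have h2 : ⟪g, g⟫_ℝ = ‖g‖ ^ 2 := real_inner_self_eq_norm_sq g
    have h3 : ⟪g, ψ⟫_ℝ = c := by rw [hc, real_inner_comm]
    rw [h1, hy, inner_sub_left, inner_sub_right, inner_sub_right, real_inner_smul_left,
      real_inner_smul_left, real_inner_smul_right, real_inner_smul_right, hψψ, h3, ← hc, h2]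
    ring
  have hg : g = c • ψ + y := by
    rw [hy]; abel
  have hBgg : B g g = c ^ 2 * ε₀ + B y y := by
    have hyψ : B y ψ = 0 := by rw [hB y ψ]; exact hEL y hyo
    conv_lhs => rw [hg]
    simp only [map_add, map_smul, LinearMap.add_apply, LinearMap.smul_apply, smul_eq_mul]
    rw [hε, hEL y hyo, hyψ]
    ring
  have hgy := hgap y hyo
  rw [hny] at hgy
  rw [hBgg]
  nlinarith [hgy, sq_nonneg c]

/-- **Angle form.** With `ε₀ < ε₁`: `‖g‖² - ⟪ψ,g⟫² ≤ (B g g - ε₀‖g‖²)/(ε₁ - ε₀)`; for a unit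
trial vector the left side is `sin² θ(g, ψ)` and the numerator is `q - ε₀`, `q` its Rayleigh
quotient. [folklore] -/
theorem soloBlind_temple_angle (B : E →ₗ[ℝ] E →ₗ[ℝ] ℝ) (hB : ∀ x y, B x y = B y x)
    (ψ : E) (hψ : ‖ψ‖ = 1) (ε₀ ε₁ : ℝ) (hε : B ψ ψ = ε₀)
    (hEL : ∀ y, ⟪ψ, y⟫_ℝ = 0 → B ψ y = 0)
    (hgap : ∀ y, ⟪ψ, y⟫_ℝ = 0 → ε₁ * ‖y‖ ^ 2 ≤ B y y) (hlt : ε₀ < ε₁) (g : E) :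
    ‖g‖ ^ 2 - ⟪ψ, g⟫_ℝ ^ 2 ≤ (B g g - ε₀ * ‖g‖ ^ 2) / (ε₁ - ε₀) := by
  rw [le_div_iff₀ (sub_pos.mpr hlt), mul_comm]
  exact soloBlind_temple_gap B hB ψ hψ ε₀ ε₁ hε hEL hgap g

/-- **Distance form (Step 2 surrogate).** For a UNIT trial vector `g` there is a sign `σ = ±1`
with `‖g - σ ψ‖² ≤ 2 (B g g - ε₀)/(ε₁ - ε₀)`: closeness of the Rayleigh quotient to the bottom,
measured against the gap, forces closeness to the ground state up to sign. (Uses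
`‖g - σψ‖² = 2(1 - |⟪ψ,g⟫|) ≤ 2(1 - ⟪ψ,g⟫²)` since `|⟪ψ,g⟫| ≤ 1`.) [folklore] -/
theorem soloBlind_temple_dist (B : E →ₗ[ℝ] E →ₗ[ℝ] ℝ) (hB : ∀ x y, B x y = B y x)
    (ψ : E) (hψ : ‖ψ‖ = 1) (ε₀ ε₁ : ℝ) (hε : B ψ ψ = ε₀)
    (hEL : ∀ y, ⟪ψ, y⟫_ℝ = 0 → B ψ y = 0)
    (hgap : ∀ y, ⟪ψ, y⟫_ℝ = 0 → ε₁ * ‖y‖ ^ 2 ≤ B y y) (hlt : ε₀ < ε₁)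
    (g : E) (hg : ‖g‖ = 1) :
    ∃ σ : ℝ, (σ = 1 ∨ σ = -1) ∧ ‖g - σ • ψ‖ ^ 2 ≤ 2 * (B g g - ε₀) / (ε₁ - ε₀) := by
  set c := ⟪ψ, g⟫_ℝ with hc
  have hang := soloBlind_temple_angle B hB ψ hψ ε₀ ε₁ hε hEL hgap hlt g
  rw [hg, one_pow, mul_one] at hang
  have hcle : |c| ≤ 1 := by
    have := abs_real_inner_le_norm ψ g
    rw [hψ, hg, one_mul] at this
    exact this
  have hψψ : ⟪ψ, ψ⟫_ℝ = 1 := by rw [real_inner_self_eq_norm_sq, hψ, one_pow]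
  have hgg : ⟪g, g⟫_ℝ = 1 := by rw [real_inner_self_eq_norm_sq, hg, one_pow]
  -- distance for a sign σ with σ c = |c| and σ² = 1
  have key : ∀ σ : ℝ, σ * c = |c| → σ ^ 2 = 1 → ‖g - σ • ψ‖ ^ 2 = 2 * (1 - |c|) := by
    intro σ hσc hσ2
    have h1 : ‖g - σ • ψ‖ ^ 2 = ⟪g - σ • ψ, g - σ • ψ⟫_ℝ := (real_inner_self_eq_norm_sq _).symm
    have h3 : ⟪g, ψ⟫_ℝ = c := by rw [hc, real_inner_comm]
    rw [h1, inner_sub_left, inner_sub_right, inner_sub_right, real_inner_smul_left,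
      real_inner_smul_left, real_inner_smul_right, real_inner_smul_right, hψψ, hgg, h3, ← hc]
    have : σ * σ = 1 := by rw [← sq]; exact hσ2
    nlinarith [hσc, this]
  have hpos : 0 < ε₁ - ε₀ := sub_pos.mpr hlt
  have hbound : 2 * (1 - |c|) ≤ 2 * (B g g - ε₀) / (ε₁ - ε₀) := by
    have h2 : 1 - |c| ≤ 1 - c ^ 2 := by
      have : c ^ 2 = |c| ^ 2 := (sq_abs c).symm
      nlinarith [abs_nonneg c, hcle, this]
    rw [mul_div_assoc]
    linarith [hang, h2]
  by_cases h0 : 0 ≤ c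
  · refine ⟨1, Or.inl rfl, ?_⟩
    rw [key 1 (by rw [one_mul, abs_of_nonneg h0]) (one_pow 2)]
    exact hbound
  · refine ⟨-1, Or.inr rfl, ?_⟩
    rw [key (-1) (by rw [neg_one_mul, abs_of_neg (lt_of_not_ge h0)]) (by norm_num)]
    exact hbound

/-- **Euler–Lagrange from minimality.** If `ε₀ ‖x‖² ≤ B x x` for all `x` (so `ε₀` is a lower
bound of the form) and the unit vector `ψ` attains it, `B ψ ψ = ε₀`, then `ψ` is `B`-orthogonal
to `ψ^⊥`: the first variation `s ↦ B (ψ + s y) (ψ + s y) - ε₀ ‖ψ + s y‖² = 2 s B ψ y + O(s²) ≥ 0`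
forces `B ψ y = 0`. [folklore] -/
theorem soloBlind_euler_lagrange_of_min (B : E →ₗ[ℝ] E →ₗ[ℝ] ℝ) (hB : ∀ x y, B x y = B y x)
    (ψ : E) (hψ : ‖ψ‖ = 1) (ε₀ : ℝ) (hε : B ψ ψ = ε₀) (hmin : ∀ x, ε₀ * ‖x‖ ^ 2 ≤ B x x)
    (y : E) (hy : ⟪ψ, y⟫_ℝ = 0) : B ψ y = 0 := by
  set b := B ψ y with hb
  set A := B y y - ε₀ * ‖y‖ ^ 2 with hA
  have hψψ : ⟪ψ, ψ⟫_ℝ = 1 := by rw [real_inner_self_eq_norm_sq, hψ, one_pow]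
  -- the variation inequality: 0 ≤ 2 s b + s² A for every real s
  have hvar : ∀ s : ℝ, 0 ≤ 2 * s * b + s ^ 2 * A := by
    intro s
    have h1 := hmin (ψ + s • y)
    have hn : ‖ψ + s • y‖ ^ 2 = 1 + s ^ 2 * ‖y‖ ^ 2 := by
      have e1 : ‖ψ + s • y‖ ^ 2 = ⟪ψ + s • y, ψ + s • y⟫_ℝ := (real_inner_self_eq_norm_sq _).symm
      have e2 : ⟪y, ψ⟫_ℝ = 0 := by rw [real_inner_comm]; exact hy
      rw [e1, inner_add_left, inner_add_right, inner_add_right, real_inner_smul_left,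
        real_inner_smul_left, real_inner_smul_right, real_inner_smul_right, hψψ, hy, e2,
        real_inner_self_eq_norm_sq]
      ring
    have hq : B (ψ + s • y) (ψ + s • y) = ε₀ + 2 * s * b + s ^ 2 * B y y := by
      have hyψ : B y ψ = b := by rw [hB y ψ]
      simp only [map_add, map_smul, LinearMap.add_apply, LinearMap.smul_apply, smul_eq_mul]
      rw [hε, hyψ, ← hb]
      ring
    rw [hn, hq] at h1
    rw [hA]
    nlinarith [h1]
  -- choose s = -b/(|A|+1)
  by_contra hne
  have hpos : 0 < |A| + 1 := by positivity
  have h := hvar (-b / (|A| + 1))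
  have hb2 : 0 < b ^ 2 := by positivity
  -- 2 s b + s² A = -2b²/(|A|+1) + b² A/(|A|+1)² ≤ -2b²/(|A|+1) + b²/(|A|+1) < 0
  have hAle : A ≤ |A| := le_abs_self A
  have key : 2 * (-b / (|A| + 1)) * b + (-b / (|A| + 1)) ^ 2 * A
      ≤ -(b ^ 2) / (|A| + 1) := by
    rw [div_pow, neg_sq]
    have e : 2 * (-b / (|A| + 1)) * b = -2 * b ^ 2 / (|A| + 1) := by ring
    rw [e]
    have hsq : b ^ 2 / (|A| + 1) ^ 2 * A ≤ b ^ 2 / (|A| + 1) ^ 2 * (|A| + 1) := by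
      apply mul_le_mul_of_nonneg_left (by linarith) (by positivity)
    have e2 : b ^ 2 / (|A| + 1) ^ 2 * (|A| + 1) = b ^ 2 / (|A| + 1) := by
      field_simp
    rw [e2] at hsq
    have e3 : -2 * b ^ 2 / (|A| + 1) + b ^ 2 / (|A| + 1) = -(b ^ 2) / (|A| + 1) := by ring
    linarith [hsq, e3]
  have hneg : -(b ^ 2) / (|A| + 1) < 0 := by
    rw [neg_div]; exact neg_neg_of_pos (div_pos hb2 hpos)
  linarith [h, key, hneg]

/-- **Step 2 from the gap, ground-state form.** If `ε₀` is the bottom of the form (`ε₀‖x‖² ≤ B x x`),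
attained at the unit vector `ψ`, and `ε₁ ‖y‖² ≤ B y y` on `ψ^⊥` with `ε₀ < ε₁` (simple, isolated
bottom), then every unit trial vector `g` with Rayleigh quotient `q = B g g` satisfies
`‖g - σ ψ‖² ≤ 2 (q - ε₀)/(ε₁ - ε₀)` for a sign `σ`. [folklore; this is the form in which CCM's
Step 2 reduces to a relative spectral-gap estimate, solo-blind s8] -/
theorem soloBlind_temple_dist_of_ground (B : E →ₗ[ℝ] E →ₗ[ℝ] ℝ) (hB : ∀ x y, B x y = B y x)
    (ψ : E) (hψ : ‖ψ‖ = 1) (ε₀ ε₁ : ℝ) (hε : B ψ ψ = ε₀) (hmin : ∀ x, ε₀ * ‖x‖ ^ 2 ≤ B x x)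
    (hgap : ∀ y, ⟪ψ, y⟫_ℝ = 0 → ε₁ * ‖y‖ ^ 2 ≤ B y y) (hlt : ε₀ < ε₁)
    (g : E) (hg : ‖g‖ = 1) :
    ∃ σ : ℝ, (σ = 1 ∨ σ = -1) ∧ ‖g - σ • ψ‖ ^ 2 ≤ 2 * (B g g - ε₀) / (ε₁ - ε₀) :=
  soloBlind_temple_dist B hB ψ hψ ε₀ ε₁ hε
    (soloBlind_euler_lagrange_of_min B hB ψ hψ ε₀ hε hmin) hgap hlt g hg

end Summit.RiemannHypothesis.RiemannHypothesis.Theorems
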